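/-
Copyright (c) 2026. All rights reserved.
Released under Apache 2.0 license as described in the file LICENSE.
-/
import Literature.AlgebraicGeometry.Motives.TypeIIQuaternionFrame
import HarnessLib

/-!
# The joint commutant of Shimura's type-II family is the quaternion algebra
# (the "generic member of a type-II family has `End = D`", fixed-part form, real side)

Family `hodge`, layer `Literature/AlgebraicGeometry/Motives`; THEOREMS ONLY (two plumbing `def`s with
bodies; no named fact, no `sorry`; D-0026). Sequel to `Motives/TypeIIQuaternionFrame` (quaternionic
coordinates `Φ : D_ℝⁿ ≃ W` of a type-II frame `(W, A, B, E, x)`, the operators `ρ(M)`, the Gram formula,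
the base point `Dq`, the torus `Γ(P)` and the nilpotent `σ`).

CONTEXT (route SplitImpliesAll, crux `NonsplitSixfoldCells`; director: "pointedness at a GENERIC simple
type-II member is not given"). Shimura [Shimura1963AnalyticFamilies, §4] proves that the generic member of
the analytic family of polarized abelian varieties with a TYPE-II endomorphism structure (indefinite
quaternion algebra `D/ℚ`) has endomorphism algebra exactly `D`; van Geemen [vanGeemen1994HodgeAV, proof of
Thm. 6.11, with 5.5–5.10] gives the Hodge-theoretic mechanism: an endomorphism that is Hodge for the general
complex structure of the domain is Hodge for a whole algebraic family `{g J g⁻¹}` of them, and the joint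
commutant of such a family is computed. This file formalizes that mechanism for the type-II sub-domain in
the EXPLICIT coordinates of `TypeIIQuaternionFrame`:

* §1 the `(n+1)`-parameter real-algebraic family **`J(P, t) = d^{-1/2} ρ((1 - tσ) Γ(P)⁻¹ Dq Γ(P) (1 + tσ))`**
  (`Pᵢ ≠ 0`, `t ∈ ℝ`) of points of the type-II sub-domain: `Frame.JP_JP` (`J² = -1`), `Frame.E_JP_JP`
  (`E`-isometry), `Frame.E_JP_pos` (`E(v, Jv) > 0`, `v ≠ 0`), `Frame.lam_JP` / `A_JP` / `B_JP` (commutes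
  with `λ(D_ℝ)`, so with `A = α_ℝ` and `B = j_ℝ`) — i.e. points of Deligne's `X⁺` [Deligne1982HodgeCycles,
  proof of Thm. 4.8 (a′), (b′)] commuting with `j`;
* §2 the extraction and the commutant: `Γ(P)⁻¹ Dq Γ(P) = A(P) = Σᵢ Pᵢ² Eᵢᵢ(iu₊) + Pᵢ⁻² Eᵢᵢ(iu₋)`
  (`Frame.middle_eq_Amat`), `m(P,t) = A + t(Aσ - σA) - t²σAσ` (`Frame.mMatP_eq`); THREE-POINT EXTRACTION
  (`Frame.three_point`, `t = 1, 2, 3`) and BLOCK EXTRACTION (`Frame.extract_block`, `Pᵢ = 1, 2, 3`) replace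
  "very general parameter" arguments by plain linear algebra; the GLUING IDENTITY
  `Eᵢᵢ(iu₊)σ - σEᵢᵢ(iu₊) = Eᵢ₀(iu₊) + (q₀/qᵢ)E₀ᵢ(iu₊)` (`Frame.Nmat_comm_σ`); the COMMUTANT LEMMA
  (`Frame.exists_eq_smul_of_comm`): an `ℝ`-linear map of `D_ℝⁿ` commuting with right multiplication by the
  `Eᵢᵢ(iu±)` and by the gluing elements is left multiplication by a quaternion (the `Eᵢᵢ(iu±)` generate
  all `Eᵢᵢ(c)` as an `ℝ`-algebra since `(iu₋)(iu₊) = -d u₊`; the gluing elements identify the blocks);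
* **`Frame.exists_eq_lam_of_forall_comm_JP`** (MAIN): an `ℝ`-linear `f : W → W` with `f J(P,t) = J(P,t) f`
  for all `Pᵢ > 0`, `t > 0` is `λ(δ)` for some `δ ∈ D_ℝ = ℍ[ℝ,-d,b]`.

CONSEQUENCE FOR THE CELL (informal; the `WeilDatum` packaging is NOT in this file): for a rational type-II
Weil datum `(V, K, ψ, j)` with its `j`-adapted orthogonal frame (`Motives/WeilDiscriminantTypeII`), the
members `J(P,t)` lie in `𝔖(j)`, and a `g ∈ End_ℚ(V)` that is a Hodge endomorphism of every `J(P,t)` has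
`g_ℝ ∈ λ(D_ℝ)`, whence `g ∈ End_ℚ(V) ∩ D_ℝ = D = K ⊕ Kj`: the common endomorphism algebra of the type-II
family is `D` — Shimura's statement in fixed-part form. HONEST REMARKS. (1) This is the FIXED-PART
(family) form; the SINGLE very general member (`End = D` for one `J`, which needs a transcendence /
Baire argument on the parameters) is not here. (2) The `ℚ`-descent `End_ℚ(V) ∩ λ(D_ℝ) = K ⊕ Kj` and the
`endAlg`/`𝔖(j)` dictionary on a `WeilDatum` are routine but NOT in this file. (3) Nothing here is about
abelian varieties or algebraic cycles.

## References

* [Shimura1963AnalyticFamilies] G. Shimura, On analytic families of polarized abelian varieties and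
  automorphic functions, Ann. of Math. 78 (1963), §4 (Type II; endomorphism algebra of the generic member).
* [vanGeemen1994HodgeAV] B. van Geemen, An introduction to the Hodge conjecture for abelian varieties,
  LNM 1594 (1994), 5.5–5.10 and proof of Thm. 6.11.
* [vanGeemenVerra2003QuaternionicPryms] B. van Geemen, A. Verra, Topology 42 (2003), Lemma 4.5 (proof).
* [Deligne1982HodgeCycles] P. Deligne, LNM 900 (1982), proof of Thm. 4.8, pp. 47–49.
-/

noncomputable section

open Module Matrix Finset
open scoped Quaternion

namespace Literature.AlgebraicGeometry.Motives.TypeIIQuaternionFrame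

universe u

/-! ## §0 Four more identities in `ℍ[ℝ,-d,b]` -/

section Quaternion

variable {d b β : ℝ}

/-- `(i u₋)(i u₊) = -d · u₊`. [cite: vanGeemenVerra2003QuaternionicPryms, Lemma 4.5 (proof)] -/
theorem qi_um_qi_up (hβ : β * β = b) (hβ0 : β ≠ 0) :
    qi d b * um d b β * (qi d b * up d b β) = (-d) • up d b β := by
  subst hβ; ext <;> simp [qi, up, um] <;> field_simp <;> ring

/-- `(i u₊)(i u₋) = -d · u₋`. [cite: vanGeemenVerra2003QuaternionicPryms, Lemma 4.5 (proof)] -/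
theorem qi_up_qi_um (hβ : β * β = b) (hβ0 : β ≠ 0) :
    qi d b * up d b β * (qi d b * um d b β) = (-d) • um d b β := by
  subst hβ; ext <;> simp [qi, up, um] <;> field_simp <;> ring

/-- `i u₊ + i u₋ = i`. [cite: vanGeemenVerra2003QuaternionicPryms, Lemma 4.5 (proof)] -/
theorem qi_up_add_qi_um : qi d b * up d b β + qi d b * um d b β = qi d b := by
  rw [← mul_add, up_add_um, mul_one]

/-- `i (i u₊) = -d · u₊`. [cite: vanGeemenVerra2003QuaternionicPryms, Lemma 4.5 (proof)] -/
theorem qi_qi_up : qi d b * (qi d b * up d b β) = (-d) • up d b β := by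
  rw [← mul_assoc, qi_mul_qi, smul_mul_assoc, one_mul]

end Quaternion

namespace Frame

variable {W : Type u} [AddCommGroup W] [Module ℝ W] {n : ℕ} {d b β : ℝ} (F : Frame W n d b β)

section Unipotent

variable [NeZero n]

/-! ## §1 The family `J(P, t)` -/

/-- The matrix `m(P, t) = (1 - tσ) Γ(P)⁻¹ Dq Γ(P) (1 + tσ)` of `J(P, t)`.
[cite: vanGeemen1994HodgeAV, proof of Thm. 6.11] -/
def mMatP (P : Fin n → ℝ) (t : ℝ) : Matrix (Fin n) (Fin n) ℍ[ℝ,-d,b] :=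
  (1 - t • F.σ) * (F.Γ (fun i => (P i)⁻¹) * Dq * F.Γ P) * (1 + t • F.σ)

/-- **The type-II family** `J(P, t) = d^{-1/2} ρ(m(P, t))` (`Pᵢ ≠ 0`, `t ∈ ℝ`): the diagonal CM point
`d^{-1/2}ρ(Dq)` moved by the torus `Γ(P)` and the unipotent `1 + tσ`.
[cite: vanGeemen1994HodgeAV, proof of Thm. 6.11] [cite: Shimura1963AnalyticFamilies, §4] -/
def JP (P : Fin n → ℝ) (t : ℝ) : W →ₗ[ℝ] W := (Real.sqrt d)⁻¹ • F.ρ (F.mMatP P t)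

/-- `m(P,t)² = -d`. [cite: vanGeemen1994HodgeAV, proof of Thm. 6.11] -/
theorem mMatP_mul_mMatP (P : Fin n → ℝ) (hP : ∀ i, P i ≠ 0) (t : ℝ) :
    F.mMatP P t * F.mMatP P t = (-d) • (1 : Matrix (Fin n) (Fin n) ℍ[ℝ,-d,b]) := by
  have h1 : ∀ X : Matrix (Fin n) (Fin n) ℍ[ℝ,-d,b], (1 + t • F.σ) * ((1 - t • F.σ) * X) = X :=
    fun X => by rw [← mul_assoc, unipotent_mul, one_mul]
  have h2 : ∀ X : Matrix (Fin n) (Fin n) ℍ[ℝ,-d,b], F.Γ P * (F.Γ (fun i => (P i)⁻¹) * X) = X :=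
    fun X => by rw [← mul_assoc, Γ_mul_Γ_inv _ _ hP, one_mul]
  have h3 : ∀ X : Matrix (Fin n) (Fin n) ℍ[ℝ,-d,b], Dq * (Dq * X) = (-d) • X :=
    fun X => by rw [← mul_assoc, Dq_mul_Dq, smul_mul_assoc, one_mul]
  have h2' : ∀ X : Matrix (Fin n) (Fin n) ℍ[ℝ,-d,b], F.Γ (fun i => (P i)⁻¹) * (F.Γ P * X) = X :=
    fun X => by rw [← mul_assoc, Γ_inv_mul_Γ _ _ hP, one_mul]
  simp only [mMatP, mul_assoc]
  rw [h1, h2, h3, Matrix.mul_smul, Matrix.mul_smul, h2', unipotent_mul']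

/-- `J(P,t)² = -1`. [cite: vanGeemen1994HodgeAV, 5.5] -/
theorem JP_JP (P : Fin n → ℝ) (hP : ∀ i, P i ≠ 0) (t : ℝ) (w : W) : F.JP P t (F.JP P t w) = -w := by
  have h := F.mMatP_mul_mMatP P hP t
  have h2 : F.ρ (F.mMatP P t) (F.ρ (F.mMatP P t) w) = -(d • w) := by
    rw [← Module.End.mul_apply, F.ρ_mul, h, F.ρ_smul, F.ρ_one, LinearMap.smul_apply,
      LinearMap.id_apply, neg_smul]
  simp only [JP, LinearMap.smul_apply, map_smul, h2, smul_neg, smul_smul]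
  rw [← mul_assoc, F.inv_sqrt_mul_inv_sqrt_mul_d, one_smul]

/-- `J(P,t)` commutes with the left action of `D_ℝ` (in particular with `A = α` and `B = j`).
[cite: vanGeemen1994HodgeAV, 5.7] -/
theorem lam_JP (P : Fin n → ℝ) (t : ℝ) (δ : ℍ[ℝ,-d,b]) (w : W) :
    F.lam δ (F.JP P t w) = F.JP P t (F.lam δ w) := by
  simp only [JP, LinearMap.smul_apply, map_smul, lam_ρ]

/-- `A J = J A`. [cite: vanGeemen1994HodgeAV, 5.7] -/
theorem A_JP (P : Fin n → ℝ) (t : ℝ) (w : W) : F.A (F.JP P t w) = F.JP P t (F.A w) := by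
  rw [← lam_qi]; exact F.lam_JP P t _ w

/-- `B J = J B` (type II). [cite: vanGeemen1994HodgeAV, 5.7] -/
theorem B_JP (P : Fin n → ℝ) (t : ℝ) (w : W) : F.B (F.JP P t w) = F.JP P t (F.B w) := by
  rw [← lam_qj]; exact F.lam_JP P t _ w

/-- `⟪g m, h m⟫ = d ⟪g, h⟫`. [cite: vanGeemen1994HodgeAV, proof of Thm. 6.11] -/
theorem ip_mMatP (P : Fin n → ℝ) (hP : ∀ i, P i ≠ 0) (t : ℝ) (g h : Fin n → ℍ[ℝ,-d,b]) :
    F.ip (g ᵥ* F.mMatP P t) (h ᵥ* F.mMatP P t) = d * F.ip g h := by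
  have hPi : ∀ i, (P i)⁻¹ ≠ 0 := fun i => inv_ne_zero (hP i)
  simp only [mMatP, ← Matrix.vecMul_vecMul]
  rw [ip_unipotent, ip_Γ _ _ hP, ip_Dq, ip_Γ _ _ hPi, sub_eq_add_neg, ← neg_smul, ip_unipotent]

/-- `E(J v, J w) = E(v, w)`. [cite: vanGeemen1994HodgeAV, 5.5–5.6] -/
theorem E_JP_JP (P : Fin n → ℝ) (hP : ∀ i, P i ≠ 0) (t : ℝ) (v w : W) :
    F.E (F.JP P t v) (F.JP P t w) = F.E v w := by
  obtain ⟨g, rfl⟩ := F.Φ.surjective v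
  obtain ⟨h, rfl⟩ := F.Φ.surjective w
  simp only [JP, LinearMap.smul_apply, map_smul, LinearMap.smul_apply, smul_eq_mul, ρ_Φ, E_Φ]
  rw [ip_mMatP _ _ hP]
  linear_combination (F.ip g h) * F.inv_sqrt_mul_inv_sqrt_mul_d

/-- `E(v, J v) > 0` for `v ≠ 0`. [cite: vanGeemen1994HodgeAV, 5.6–5.7] -/
theorem E_JP_pos (P : Fin n → ℝ) (hP : ∀ i, P i ≠ 0) (t : ℝ) {v : W} (hv : v ≠ 0) :
    0 < F.E v (F.JP P t v) := by
  obtain ⟨g, rfl⟩ := F.Φ.surjective v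
  have hg : g ≠ 0 := fun h => hv (by rw [h, map_zero])
  set hh := (g ᵥ* (1 - t • F.σ)) ᵥ* F.Γ (fun i => (P i)⁻¹) with hh_def
  have hg' : g = (hh ᵥ* F.Γ P) ᵥ* (1 + t • F.σ) := by
    rw [hh_def, Matrix.vecMul_vecMul, Matrix.vecMul_vecMul, Matrix.vecMul_vecMul,
      ← Matrix.mul_assoc (F.Γ fun i => (P i)⁻¹), Γ_inv_mul_Γ _ _ hP, Matrix.one_mul,
      unipotent_mul', Matrix.vecMul_one]
  have hm : g ᵥ* F.mMatP P t = ((hh ᵥ* Dq) ᵥ* F.Γ P) ᵥ* (1 + t • F.σ) := by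
    simp only [mMatP, hh_def, ← Matrix.vecMul_vecMul]
  have hhne : hh ≠ 0 := by
    intro h0
    apply hg
    have e := hg'
    rw [h0, Matrix.zero_vecMul, Matrix.zero_vecMul] at e
    exact e
  simp only [JP, LinearMap.smul_apply, map_smul, smul_eq_mul, ρ_Φ, E_Φ]
  refine mul_pos (inv_pos.2 F.sqrt_d_pos) ?_
  rw [hm]
  conv_rhs => rw [hg']
  rw [ip_unipotent, ip_Γ _ _ hP]
  exact F.ip_self_Dq_pos hh hhne

/-! ## §2 Extraction of the distinguished operators and the commutant theorem -/

/-- The diagonal matrix units `Nᵢ,± = Eᵢᵢ(i u±)`. [cite: vanGeemen1994HodgeAV, proof of Thm. 6.11] -/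
def Nmat (_F : Frame W n d b β) (i : Fin n) (s : Bool) : Matrix (Fin n) (Fin n) ℍ[ℝ,-d,b] :=
  Matrix.single i i (qi d b * (if s then up d b β else um d b β))

/-- The middle factor `A(P) = Σᵢ Pᵢ² Nᵢ₊ + Pᵢ⁻² Nᵢ₋`. [cite: vanGeemen1994HodgeAV, proof of Thm. 6.11] -/
def Amat (P : Fin n → ℝ) : Matrix (Fin n) (Fin n) ℍ[ℝ,-d,b] :=
  ∑ i, ((P i ^ 2) • F.Nmat i true + (P i ^ 2)⁻¹ • F.Nmat i false)

omit [NeZero n] in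
/-- `diag(w) = Σᵢ Eᵢᵢ(wᵢ)`. [cite: vanGeemen1994HodgeAV, proof of Thm. 6.11] -/
theorem diagonal_eq_sum_single (w : Fin n → ℍ[ℝ,-d,b]) :
    Matrix.diagonal w = ∑ i, Matrix.single i i (w i) := by
  refine Matrix.ext fun a c => ?_
  simp only [Matrix.diagonal_apply, Matrix.sum_apply, Matrix.single, Matrix.of_apply]
  by_cases hac : a = c
  · subst hac
    rw [Finset.sum_eq_single_of_mem a (Finset.mem_univ a)]
    · simp
    · intro i _ hi; simp [hi]
  · rw [if_neg hac, Finset.sum_eq_zero]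
    intro i _; rw [if_neg]; rintro ⟨h1, h2⟩; exact hac (h1.symm.trans h2)

omit [NeZero n] in
/-- `Γ(P)⁻¹ Dq Γ(P) = A(P)`. [cite: vanGeemen1994HodgeAV, proof of Thm. 6.11] -/
theorem middle_eq_Amat (P : Fin n → ℝ) (hP : ∀ i, P i ≠ 0) :
    F.Γ (fun i => (P i)⁻¹) * Dq * F.Γ P = F.Amat P := by
  rw [Γ, Dq, Γ, Matrix.diagonal_mul_diagonal, Matrix.diagonal_mul_diagonal, diagonal_eq_sum_single, Amat]
  refine Finset.sum_congr rfl fun i _ => ?_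
  rw [gam_inv_qi_gam F.β_mul_β F.β_ne (hP i), Nmat, Nmat, Matrix.single_add, Matrix.smul_single,
    Matrix.smul_single]
  simp

/-- The general family `m(P, t) = (1 - tσ) A(P) (1 + tσ)` and its quadratic expansion in `t`.
[cite: vanGeemen1994HodgeAV, proof of Thm. 6.11] -/
theorem conj_expand (t : ℝ) (X : Matrix (Fin n) (Fin n) ℍ[ℝ,-d,b]) :
    (1 - t • F.σ) * X * (1 + t • F.σ) = X + t • (X * F.σ - F.σ * X) - (t * t) • (F.σ * X * F.σ) := by
  simp only [sub_mul, mul_add, one_mul, mul_one, smul_mul_assoc, mul_smul_comm, smul_sub, smul_smul]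
  abel

/-- THREE-POINT EXTRACTION: if `X + tY + t²Z = 0` for `t = 1, 2, 3` then `X = Y = Z = 0`.
[cite: vanGeemen1994HodgeAV, proof of Thm. 6.11] -/
theorem three_point {M : Type*} [AddCommGroup M] [Module ℝ M] {X Y Z : M}
    (h1 : X + (1 : ℝ) • Y - ((1 : ℝ) * 1) • Z = 0) (h2 : X + (2 : ℝ) • Y - ((2 : ℝ) * 2) • Z = 0)
    (h3 : X + (3 : ℝ) • Y - ((3 : ℝ) * 3) • Z = 0) : X = 0 ∧ Y = 0 ∧ Z = 0 := by
  have hZ : Z = 0 := by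
    linear_combination (norm := module) (-(1:ℝ)/2) • h1 + (1 : ℝ) • h2 - ((1:ℝ)/2) • h3
  have hY : Y = 0 := by linear_combination (norm := module) (-(1 : ℝ)) • h1 + (1 : ℝ) • h2 + (3 : ℝ) • hZ
  refine ⟨?_, hY, hZ⟩
  linear_combination (norm := module) h1 - (1:ℝ) • hY + (1 : ℝ) • hZ

/-- `m(P, t) = A(P) + t (A(P)σ - σA(P)) - t² σA(P)σ`. [cite: vanGeemen1994HodgeAV, proof of Thm. 6.11] -/
theorem mMat_eq (P : Fin n → ℝ) (hP : ∀ i, P i ≠ 0) (t : ℝ) :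
    F.mMatP P t = F.Amat P + t • (F.Amat P * F.σ - F.σ * F.Amat P) - (t * t) • (F.σ * F.Amat P * F.σ) := by
  rw [mMatP, middle_eq_Amat _ _ hP, conj_expand]

/-- From `[f, ρ(m(P,t))] = 0` for `t = 1, 2, 3`: `[f, ρ(A(P))] = 0` and `[f, ρ(A(P)σ - σA(P))] = 0`.
[cite: vanGeemen1994HodgeAV, proof of Thm. 6.11] -/
theorem comm_Amat_of_comm_mMatP (f : W →ₗ[ℝ] W) (P : Fin n → ℝ) (hP : ∀ i, P i ≠ 0)
    (h : ∀ t : ℝ, 0 < t → f ∘ₗ F.ρ (F.mMatP P t) = F.ρ (F.mMatP P t) ∘ₗ f) :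
    f ∘ₗ F.ρ (F.Amat P) = F.ρ (F.Amat P) ∘ₗ f ∧
      f ∘ₗ F.ρ (F.Amat P * F.σ - F.σ * F.Amat P) = F.ρ (F.Amat P * F.σ - F.σ * F.Amat P) ∘ₗ f := by
  have key : ∀ t : ℝ, 0 < t →
      (f ∘ₗ F.ρ (F.Amat P) - F.ρ (F.Amat P) ∘ₗ f) +
        t • (f ∘ₗ F.ρ (F.Amat P * F.σ - F.σ * F.Amat P) - F.ρ (F.Amat P * F.σ - F.σ * F.Amat P) ∘ₗ f) -
        (t * t) • (f ∘ₗ F.ρ (F.σ * F.Amat P * F.σ) - F.ρ (F.σ * F.Amat P * F.σ) ∘ₗ f) = 0 := by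
    intro t ht
    have hc := h t ht
    rw [mMat_eq _ _ hP, ρ_sub, ρ_add, ρ_smul, ρ_smul] at hc
    ext w
    have hw := LinearMap.congr_fun hc w
    simp only [LinearMap.comp_apply, LinearMap.add_apply, LinearMap.sub_apply, LinearMap.smul_apply,
      map_add, map_sub, map_smul, LinearMap.zero_apply] at hw ⊢
    rw [← sub_eq_zero] at hw
    linear_combination (norm := module) hw
  obtain ⟨hX, hY, -⟩ := three_point (key 1 one_pos) (key 2 two_pos) (key 3 three_pos)
  exact ⟨sub_eq_zero.1 hX, sub_eq_zero.1 hY⟩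

omit [NeZero n] in
/-- Varying one torus parameter: `A(update 1 i c) = c² Nᵢ₊ + c⁻² Nᵢ₋ + (Σ_{k ≠ i} Nₖ₊ + Nₖ₋)`.
[cite: vanGeemen1994HodgeAV, proof of Thm. 6.11] -/
theorem Amat_update (i : Fin n) (c : ℝ) :
    F.Amat (Function.update 1 i c) = (c ^ 2) • F.Nmat i true + (c ^ 2)⁻¹ • F.Nmat i false +
      ∑ k ∈ Finset.univ.erase i, (F.Nmat k true + F.Nmat k false) := by
  rw [Amat, ← Finset.add_sum_erase _ _ (Finset.mem_univ i), Function.update_self]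
  congr 1
  refine Finset.sum_congr rfl fun k hk => ?_
  rw [Function.update_of_ne (Finset.ne_of_mem_erase hk)]
  simp

omit [NeZero n] in
/-- BLOCK EXTRACTION: if `[f, ρ(A(P))] = 0` for the three parameters `P = update 1 i c`, `c = 1, 2, 3`,
then `[f, ρ(Nᵢ₊)] = 0` and `[f, ρ(Nᵢ₋)] = 0`; the same for any `ℝ`-linear `Ψ` in place of `ρ`.
[cite: vanGeemen1994HodgeAV, proof of Thm. 6.11] -/
theorem extract_block {M : Type*} [AddCommGroup M] [Module ℝ M]
    (Ψ : Matrix (Fin n) (Fin n) ℍ[ℝ,-d,b] →ₗ[ℝ] M) (i : Fin n)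
    (h : ∀ c : ℝ, 0 < c → Ψ (F.Amat (Function.update 1 i c)) = 0) :
    Ψ (F.Nmat i true) = 0 ∧ Ψ (F.Nmat i false) = 0 := by
  have key : ∀ c : ℝ, 0 < c →
      Ψ (∑ k ∈ Finset.univ.erase i, (F.Nmat k true + F.Nmat k false)) + (c * c) • Ψ (F.Nmat i true) -
        (-(c * c)⁻¹) • Ψ (F.Nmat i false) = 0 := by
    intro c hc
    have := h c hc
    rw [Amat_update, map_add, map_add, map_smul, map_smul, pow_two] at this
    rw [neg_smul, sub_neg_eq_add, ← this]; abel
  have h1 := key 1 one_pos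
  have h2 := key 2 two_pos
  have h3 := key 3 three_pos
  norm_num at h1 h2 h3
  constructor
  · linear_combination (norm := module) ((1:ℝ)/24) • h1 - ((4:ℝ)/15) • h2 + ((9:ℝ)/40) • h3
  · linear_combination (norm := module) ((3:ℝ)/2) • h1 - ((12:ℝ)/5) • h2 + ((9:ℝ)/10) • h3

/-- THE GLUING ELEMENT: `Nᵢ₊σ - σNᵢ₊ = Eᵢ₀(iu₊) + (q₀/qᵢ)E₀ᵢ(iu₊)` for `i ≠ 0`.
[cite: vanGeemen1994HodgeAV, proof of Thm. 6.11] -/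
theorem Nmat_comm_σ {i : Fin n} (hi : i ≠ 0) :
    F.Nmat i true * F.σ - F.σ * F.Nmat i true =
      Matrix.single i 0 (qi d b * up d b β) + (F.q 0 / F.q i) • Matrix.single 0 i (qi d b * up d b β) := by
  have hup := up_mul_up F.β_mul_β F.β_ne (d := d)
  have h1 : F.Nmat i true * F.σ = Matrix.single i 0 (qi d b * up d b β) := by
    refine Matrix.ext fun a c => ?_
    simp only [Nmat, if_true, Matrix.mul_apply, Matrix.single, Matrix.of_apply]
    rw [Finset.sum_eq_single_of_mem i (Finset.mem_univ i)]
    · by_cases ha : i = a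
      · subst ha
        rcases eq_or_ne c 0 with rfl | hc
        · simp [F.σ_ne_zero hi, mul_assoc, hup]
        · simp [F.σ_ne_ne hi hc, hc.symm]
      · simp [ha]
    · intro l _ hl; simp [Ne.symm hl]
  have h2 : F.σ * F.Nmat i true = -((F.q 0 / F.q i) • Matrix.single 0 i (qi d b * up d b β)) := by
    refine Matrix.ext fun a c => ?_
    simp only [Nmat, if_true, Matrix.mul_apply, Matrix.single, Matrix.of_apply, Matrix.neg_apply,
      Matrix.smul_apply]
    rw [Finset.sum_eq_single_of_mem i (Finset.mem_univ i)]
    · by_cases hc : i = c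
      · subst hc
        rcases eq_or_ne a 0 with rfl | ha
        · simp only [F.σ_zero_ne hi, and_self, if_true]
          rw [neg_mul, smul_mul_assoc, ← mul_assoc, ← qi_mul_up (β := β), mul_assoc, hup]
        · simp [F.σ_ne_ne ha hi, ha.symm]
      · simp [hc]
    · intro l _ hl; simp [Ne.symm hl]
  rw [h1, h2, sub_neg_eq_add]

/-- THE COMMUTANT COMPUTATION in coordinates: an `ℝ`-linear `G` on `D_ℝⁿ` commuting with right
multiplication by `Eᵢᵢ(iu₊)`, `Eᵢᵢ(iu₋)` (all `i`) and by the gluing elements (all `i ≠ 0`) is LEFT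
multiplication by a quaternion. [cite: vanGeemen1994HodgeAV, proof of Thm. 6.11] -/
theorem exists_eq_smul_of_comm (G : (Fin n → ℍ[ℝ,-d,b]) →ₗ[ℝ] (Fin n → ℍ[ℝ,-d,b]))
    (hN : ∀ i s g, G (g ᵥ* F.Nmat i s) = G g ᵥ* F.Nmat i s)
    (hT : ∀ i, i ≠ 0 → ∀ g, G (g ᵥ* (F.Nmat i true * F.σ - F.σ * F.Nmat i true)) =
      G g ᵥ* (F.Nmat i true * F.σ - F.σ * F.Nmat i true)) :
    ∃ δ : ℍ[ℝ,-d,b], ∀ g, G g = δ • g := by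
  have hβ := F.β_mul_β
  have hβ0 := F.β_ne
  have hd := F.d_ne
  -- Step 1: `G` commutes with right multiplication by every `Eᵢᵢ(c)`.
  have step1 : ∀ i (c : ℍ[ℝ,-d,b]) g,
      G (g ᵥ* Matrix.single i i c) = G g ᵥ* Matrix.single i i c := by
    intro i
    have add : ∀ c c' : ℍ[ℝ,-d,b], (∀ g, G (g ᵥ* Matrix.single i i c) = G g ᵥ* Matrix.single i i c) →
        (∀ g, G (g ᵥ* Matrix.single i i c') = G g ᵥ* Matrix.single i i c') →
        ∀ g, G (g ᵥ* Matrix.single i i (c + c')) = G g ᵥ* Matrix.single i i (c + c') := by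
      intro c c' hc hc' g
      rw [Matrix.single_add, Matrix.vecMul_add, map_add, hc, hc', Matrix.vecMul_add]
    have smul : ∀ (r : ℝ) (c : ℍ[ℝ,-d,b]),
        (∀ g, G (g ᵥ* Matrix.single i i c) = G g ᵥ* Matrix.single i i c) →
        ∀ g, G (g ᵥ* Matrix.single i i (r • c)) = G g ᵥ* Matrix.single i i (r • c) := by
      intro r c hc g
      rw [← Matrix.smul_single, Matrix.vecMul_smul, map_smul, hc, Matrix.vecMul_smul]
    have mul : ∀ c c' : ℍ[ℝ,-d,b], (∀ g, G (g ᵥ* Matrix.single i i c) = G g ᵥ* Matrix.single i i c) →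
        (∀ g, G (g ᵥ* Matrix.single i i c') = G g ᵥ* Matrix.single i i c') →
        ∀ g, G (g ᵥ* Matrix.single i i (c * c')) = G g ᵥ* Matrix.single i i (c * c') := by
      intro c c' hc hc' g
      rw [show Matrix.single i i (c * c') = Matrix.single i i c * Matrix.single i i c' by
        rw [Matrix.single_mul_single_same], ← Matrix.vecMul_vecMul, hc', hc, Matrix.vecMul_vecMul]
    have hup : ∀ g, G (g ᵥ* Matrix.single i i (qi d b * up d b β)) =
        G g ᵥ* Matrix.single i i (qi d b * up d b β) := fun g => by simpa [Nmat] using hN i true g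
    have hum : ∀ g, G (g ᵥ* Matrix.single i i (qi d b * um d b β)) =
        G g ᵥ* Matrix.single i i (qi d b * um d b β) := fun g => by simpa [Nmat] using hN i false g
    have hu : ∀ g, G (g ᵥ* Matrix.single i i (up d b β)) = G g ᵥ* Matrix.single i i (up d b β) := by
      have h := smul (-d)⁻¹ _ (mul _ _ hum hup)
      rwa [qi_um_qi_up hβ hβ0, smul_smul, inv_mul_cancel₀ (neg_ne_zero.2 hd), one_smul] at h
    have hm : ∀ g, G (g ᵥ* Matrix.single i i (um d b β)) = G g ᵥ* Matrix.single i i (um d b β) := by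
      have h := smul (-d)⁻¹ _ (mul _ _ hup hum)
      rwa [qi_up_qi_um hβ hβ0, smul_smul, inv_mul_cancel₀ (neg_ne_zero.2 hd), one_smul] at h
    have h1 : ∀ g, G (g ᵥ* Matrix.single i i (1 : ℍ[ℝ,-d,b])) = G g ᵥ* Matrix.single i i 1 := by
      have h := add _ _ hu hm; rwa [up_add_um] at h
    have hi' : ∀ g, G (g ᵥ* Matrix.single i i (qi d b)) = G g ᵥ* Matrix.single i i (qi d b) := by
      have h := add _ _ hup hum; rwa [qi_up_add_qi_um] at h
    have hj : ∀ g, G (g ᵥ* Matrix.single i i (qj d b)) = G g ᵥ* Matrix.single i i (qj d b) := by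
      have h := smul β _ (add _ _ hu (smul (-1) _ hm))
      rwa [neg_one_smul, ← sub_eq_add_neg, ← qj_eq (d := d) hβ0] at h
    have hk := mul _ _ hi' hj
    intro c g
    rw [decomp c]
    exact add _ _ (add _ _ (add _ _ (smul _ _ h1) (smul _ _ hi')) (smul _ _ hj)) (smul _ _ hk) g
  -- Step 2: `G (c eᵢ) = (δ i * c) eᵢ` with `δ i = (G eᵢ)ᵢ`.
  obtain ⟨δf, proj⟩ : ∃ δf : Fin n → ℍ[ℝ,-d,b], ∀ i c, G (Pi.single i c) = Pi.single i (δf i * c) := by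
    refine ⟨fun i => (G (Pi.single i 1)) i, fun i c => ?_⟩
    have h := step1 i c (Pi.single i 1)
    rwa [vecMul_single, vecMul_single, Pi.single_eq_same, one_mul] at h
  -- Step 3: the gluing elements force `δ i = δ 0`.
  have glue : ∀ i, i ≠ 0 → δf i = δf 0 := by
    intro i hi
    have rhs : ∀ y : Fin n → ℍ[ℝ,-d,b], y ᵥ* (F.Nmat i true * F.σ - F.σ * F.Nmat i true) =
        (Pi.single 0 (y i * (qi d b * up d b β)) : Fin n → ℍ[ℝ,-d,b]) +
          (F.q 0 / F.q i) • (Pi.single i (y 0 * (qi d b * up d b β)) : Fin n → ℍ[ℝ,-d,b]) := by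
      intro y
      rw [F.Nmat_comm_σ hi, Matrix.vecMul_add, Matrix.vecMul_smul, vecMul_single, vecMul_single]
    have key : ∀ a : ℍ[ℝ,-d,b], δf 0 * (a * (qi d b * up d b β)) = δf i * a * (qi d b * up d b β) := by
      intro a
      have h := hT i hi (Pi.single i a)
      rw [rhs, rhs, proj] at h
      simp only [Pi.single_eq_same, Pi.single_eq_of_ne (Ne.symm hi), zero_mul, Pi.single_zero,
        smul_zero, add_zero, proj] at h
      simpa using congr_fun h 0
    set D := δf 0 - δf i with hD
    have e1 : D * (qi d b * up d b β) = 0 := by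
      rw [hD, sub_mul, sub_eq_zero]; simpa using key 1
    have e2 : D * (qi d b * (qi d b * up d b β)) = 0 := by
      rw [hD, sub_mul, sub_eq_zero, key (qi d b), mul_assoc]
    have eup : D * up d b β = 0 := by
      rw [qi_qi_up, mul_smul_comm] at e2
      exact (smul_eq_zero.1 e2).resolve_left (neg_ne_zero.2 hd)
    have eum : D * um d b β = 0 := by
      rw [qi_mul_up, ← mul_assoc] at e1
      have h := congrArg (· * qi d b) e1
      simp only [zero_mul, mul_assoc, qi_mul_qi, mul_smul_comm, mul_one] at h
      exact (smul_eq_zero.1 h).resolve_left (neg_ne_zero.2 hd)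
    have hD0 : D = 0 := by
      rw [← mul_one D, ← up_add_um (d := d) (b := b) (β := β), mul_add, eup, eum, add_zero]
    rw [hD] at hD0
    exact (sub_eq_zero.1 hD0).symm
  -- Step 4: assemble.
  refine ⟨δf 0, fun g => ?_⟩
  have hδ : ∀ i, δf i = δf 0 := fun i => if hi : i = 0 then by rw [hi] else glue i hi
  have hsingle : ∀ i, G (Pi.single i (g i)) = δf 0 • (Pi.single i (g i) : Fin n → ℍ[ℝ,-d,b]) := by
    intro i
    rw [proj, hδ i]
    funext k
    rcases eq_or_ne k i with rfl | hk
    · simp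
    · simp [Pi.single_eq_of_ne hk]
  conv_lhs => rw [← Finset.univ_sum_single g]
  rw [map_sum]
  simp_rw [hsingle]
  rw [← Finset.smul_sum, Finset.univ_sum_single]

/-- The `ρ`-version: an `ℝ`-linear `f : W → W` commuting with `ρ(Eᵢᵢ(iu±))` and with `ρ` of the gluing
elements is in `λ(D_ℝ)`. [cite: vanGeemen1994HodgeAV, proof of Thm. 6.11] -/
theorem exists_eq_lam_of_comm_ρ (f : W →ₗ[ℝ] W)
    (hN : ∀ i s, f ∘ₗ F.ρ (F.Nmat i s) = F.ρ (F.Nmat i s) ∘ₗ f)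
    (hT : ∀ i, i ≠ 0 → f ∘ₗ F.ρ (F.Nmat i true * F.σ - F.σ * F.Nmat i true) =
      F.ρ (F.Nmat i true * F.σ - F.σ * F.Nmat i true) ∘ₗ f) :
    ∃ δ : ℍ[ℝ,-d,b], f = F.lam δ := by
  set G : (Fin n → ℍ[ℝ,-d,b]) →ₗ[ℝ] (Fin n → ℍ[ℝ,-d,b]) :=
    F.Φ.symm.toLinearMap ∘ₗ f ∘ₗ F.Φ.toLinearMap with hG
  have hGM : ∀ M : Matrix (Fin n) (Fin n) ℍ[ℝ,-d,b], f ∘ₗ F.ρ M = F.ρ M ∘ₗ f →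
      ∀ g, G (g ᵥ* M) = G g ᵥ* M := by
    intro M hM g
    have h := LinearMap.congr_fun hM (F.Φ g)
    simp only [LinearMap.comp_apply, ρ_Φ] at h
    simp only [hG, LinearMap.comp_apply, LinearEquiv.coe_coe, h, ρ_apply, LinearEquiv.symm_apply_apply]
  obtain ⟨δ, hδ⟩ := F.exists_eq_smul_of_comm G (fun i s => hGM _ (hN i s)) (fun i hi => hGM _ (hT i hi))
  refine ⟨δ, LinearMap.ext fun w => ?_⟩
  obtain ⟨g, rfl⟩ := F.Φ.surjective w
  have h := hδ g
  simp only [hG, LinearMap.comp_apply, LinearEquiv.coe_coe] at h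
  rw [← Φ_smul_left, ← h, LinearEquiv.apply_symm_apply]

/-- `ρ` as an `ℝ`-linear map of the matrix. [cite: vanGeemen1994HodgeAV, 5.9–5.10] -/
def ρₗ : Matrix (Fin n) (Fin n) ℍ[ℝ,-d,b] →ₗ[ℝ] (W →ₗ[ℝ] W) where
  toFun := F.ρ
  map_add' := F.ρ_add
  map_smul' r M := F.ρ_smul r M

/-- **MAIN THEOREM (the joint commutant of the type-II family is `D_ℝ`).** An `ℝ`-linear `f : W → W`
commuting with `J(P, t)` for all torus parameters `Pᵢ > 0` and all `t > 0` is left multiplication by a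
quaternion: `f = λ(δ)`, `δ ∈ D_ℝ = ℍ[ℝ,-d,b]`. On a Weil datum (`W = V_ℝ`, `A = α`, `B = j`): a rational
endomorphism preserving the Hodge structures of all members of this sub-family of the type-II domain
`𝔖(j)` lies in `End_ℚ(V) ∩ D_ℝ = D = K ⊕ Kj` — the endomorphism algebra of the general member of the
type-II family is the quaternion algebra `D` (fixed-part form).
[cite: Shimura1963AnalyticFamilies, §4] [cite: vanGeemen1994HodgeAV, proof of Thm. 6.11] -/
theorem exists_eq_lam_of_forall_comm_JP (f : W →ₗ[ℝ] W)
    (hf : ∀ P : Fin n → ℝ, (∀ i, 0 < P i) → ∀ t : ℝ, 0 < t → f ∘ₗ F.JP P t = F.JP P t ∘ₗ f) :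
    ∃ δ : ℍ[ℝ,-d,b], f = F.lam δ := by
  have hc0 : (Real.sqrt d)⁻¹ ≠ 0 := inv_ne_zero F.sqrt_d_pos.ne'
  have hρ : ∀ P : Fin n → ℝ, (∀ i, 0 < P i) → ∀ t : ℝ, 0 < t →
      f ∘ₗ F.ρ (F.mMatP P t) = F.ρ (F.mMatP P t) ∘ₗ f := by
    intro P hP t ht
    have h := hf P hP t ht
    simp only [JP, LinearMap.comp_smul, LinearMap.smul_comp] at h
    exact smul_right_injective _ hc0 h
  let Ψ : Matrix (Fin n) (Fin n) ℍ[ℝ,-d,b] →ₗ[ℝ] (W →ₗ[ℝ] W) :=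
    (LinearMap.llcomp ℝ W W W f) ∘ₗ F.ρₗ - (LinearMap.lcomp ℝ W f) ∘ₗ F.ρₗ
  have Ψ_apply : ∀ M, Ψ M = f ∘ₗ F.ρ M - F.ρ M ∘ₗ f := fun M => rfl
  let Ψ' : Matrix (Fin n) (Fin n) ℍ[ℝ,-d,b] →ₗ[ℝ] (W →ₗ[ℝ] W) :=
    Ψ ∘ₗ (LinearMap.mulRight ℝ F.σ - LinearMap.mulLeft ℝ F.σ)
  have Ψ'_apply : ∀ M, Ψ' M = f ∘ₗ F.ρ (M * F.σ - F.σ * M) - F.ρ (M * F.σ - F.σ * M) ∘ₗ f :=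
    fun M => rfl
  have hpos : ∀ (i : Fin n) (c : ℝ), 0 < c → ∀ k, 0 < Function.update (1 : Fin n → ℝ) i c k := by
    intro i c hc k
    rcases eq_or_ne k i with rfl | hk
    · rw [Function.update_self]; exact hc
    · rw [Function.update_of_ne hk]; exact one_pos
  have hN : ∀ i s, f ∘ₗ F.ρ (F.Nmat i s) = F.ρ (F.Nmat i s) ∘ₗ f := by
    intro i s
    have h := F.extract_block Ψ i fun c hc => by
      rw [Ψ_apply, sub_eq_zero]
      exact (F.comm_Amat_of_comm_mMatP f _ (fun k => (hpos i c hc k).ne')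
        (hρ _ (hpos i c hc))).1
    cases s
    · exact sub_eq_zero.1 (by rw [← Ψ_apply]; exact h.2)
    · exact sub_eq_zero.1 (by rw [← Ψ_apply]; exact h.1)
  have hT : ∀ i, i ≠ 0 → f ∘ₗ F.ρ (F.Nmat i true * F.σ - F.σ * F.Nmat i true) =
      F.ρ (F.Nmat i true * F.σ - F.σ * F.Nmat i true) ∘ₗ f := by
    intro i hi
    have h := F.extract_block Ψ' i fun c hc => by
      rw [Ψ'_apply, sub_eq_zero]
      exact (F.comm_Amat_of_comm_mMatP f _ (fun k => (hpos i c hc k).ne')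
        (hρ _ (hpos i c hc))).2
    exact sub_eq_zero.1 (by rw [← Ψ'_apply]; exact h.1)
  exact F.exists_eq_lam_of_comm_ρ f hN hT

end Unipotent

end Frame

end Literature.AlgebraicGeometry.Motives.TypeIIQuaternionFrame

end
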